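import Literature.AlgebraicGeometry.Motives.AbelianVarietyWeilPairingIdealTorsionIsotropy
import Literature.GroupTheory.Abelian.PerfectPairingAnnihilatorCardUnits
import Literature.NumberTheory.NumberFields.IdealClassCoprimeRepresentative
import HarnessLib

/-!
# The annihilator identity `A[𝔟]^⊥ = A[𝔠̄′]` for the level Weil pairing under a Rosati-adjoint `𝒪`-action, and the count `#A[𝔟]·#A[𝔠] = #A[N]`
# ([MumfordAV1970] §20 pp. 184–186, §23 p. 208 and p. 233; [Shimura1998] (18.4b); [NeukirchANT1999] I §3)

Layer `Literature/AlgebraicGeometry/Motives`, namespace `Literature.AlgebraicGeometry.Motives.AbelianVariety`.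
THEOREMS ONLY (no definition, no named fact, no instance, no `sorry`).  Cell `hodgecm-mathlib` (D-0151), P6 «MOD» (crux hLiu418 =
stmt-HodgeConjecture-24832, `--supports`, count-neutral): line L3 ROOF road «DUAL-B̄», RULING #5 (A)∕(C): the `hcard` row «`#K·#K′ = n^{2g}`» of the
«DUAL-Q» assembly ★ `nonempty_dualPair_quotient_idealTorsion_geometric` read on `Ω`-points, modulo PERFECTNESS of `ē^Θ_N` (a hypothesis here; ★-fed by
Lang VII §2 Prop. 4 when `gcd(N, #K(Θ)) = 1`).  HC_CM is proved only modulo the printed citations until rung 0 closes; nothing here is about HC.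

THE MATHEMATICS.  `X` an abelian variety over a field `K`, `Θ` a Cartier divisor, `[N]` dominant; `φ : 𝒪 → End X(K)` an additive, multiplicative,
unital family over a Dedekind domain `𝒪` with `φ(N) = (·)^N`, ADJOINT for `ē^Θ_N` along a ring automorphism `c` of `𝒪`:
`ē(φ(b)P, Q) = ē(P, φ(c b)Q)` for all `b ≠ 0` (a CM action, `c` = complex conjugation, [MumfordAV1970] §23 p. 208 ∕ [Shimura1998] (18.4b); in the tree
★ `WeilDivisorPullbackOfRosatiAtPoint.weilPairingLevel_map_fibreHom_eq_of_rosati`).  Let `𝔟`, `J′` be nonzero ideals with `𝔟·J′ = (N)`.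
(ANN) If `ē^Θ_N` is RIGHT NON-DEGENERATE on `X[N](K)` then every `y ∈ X[N]` orthogonal to `X[N][𝔟] := {x ∈ X[N] : φ(𝔟)x = 1}` is killed by `φ(c(J′))`:
move `J′` twice inside its class, `J′·𝔞ₖ = (aₖ)` with `𝔞₁ + 𝔞₂ = 𝒪` (★ `NumberFields.exists_mul_eq_span_and_forall_not_dvd`, [NeukirchANT1999] I §3), so
`(a₁) + (a₂) = J′`; `φ(aₖ)X[N] ⊆ X[N][𝔟]` (`𝔟·aₖ ⊆ (N)`), hence `1 = ē(φ(aₖ)P, y) = ē(P, φ(c aₖ)y)` for all `P ∈ X[N]`, so `φ(c aₖ)y = 1` (non-degeneracy),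
and `c(J′) = (c a₁) + (c a₂)` kills `y`.  (COUNT) If moreover every `φ(r)`, `r ≠ 0`, is surjective (so the isotropy ★ `weilPairingLevel_eq_one_of_idealTorsion`
gives the converse `ē(X[N][𝔟], X[N][c J′]) = 1`), `ē^Θ_N` is non-degenerate on both sides, `X[N](K)` is finite and `K` has enough `N`-th roots of unity, then
`X[N][c J′]` IS the annihilator of `X[N][𝔟]` and **`#X[N][𝔟] · #X[N][c J′] = #X[N]`** (★ `PerfectPairingUnits.card_mul_card_eq_card_of_perfect_of_pow_eq_one`,
[MumfordAV1970] §23 p. 233).  With `J′ = c⁻¹(𝔠)`, `𝔠·c(𝔟) = (N)`: `#A[𝔟]·#A[𝔠] = #A[N] = N^{2g}` — the engine's `hcard` on points.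

* §1 **`forall_mem_map_apply_eq_one_of_forall_weilPairingLevel_eq_one`** (ANN); §2 `mem_iff_forall_weilPairingLevel_eq_one_of_idealTorsion` (the
  annihilator membership clause) and **`natCard_mul_natCard_eq_of_idealTorsion`** (COUNT).

## References
* [MumfordAV1970] D. Mumford, *Abelian Varieties* (1970), §20 pp. 184–186, §23 p. 208 and p. 233.
* [Shimura1998] G. Shimura, *Abelian Varieties with Complex Multiplication and Modular Functions* (1998), (18.4b) p. 126.
* [NeukirchANT1999] J. Neukirch, *Algebraic Number Theory* (1999), Ch. I §3.
-/

universe u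

open CategoryTheory CategoryTheory.Limits AlgebraicGeometry MonoidalCategory CartesianMonoidalCategory

noncomputable section

namespace Literature.AlgebraicGeometry.Motives

open scoped MonObj
open Literature.Algebra.Module.DivisibleTorsionIdealImage Literature.Algebra.Module.DivisibleTorsionMultiplicativity
  Literature.Algebra.Module.DivisibleTorsionPointCount Literature.NumberTheory.NumberFields

namespace AbelianVariety

variable {K : Type u} [Field K] {X : AbelianVariety K} {O : Type*} [CommRing O] [IsDedekindDomain O]
  (φ : O → X.Points K → X.Points K) (hmul : ∀ r x y, φ r (x * y) = φ r x * φ r y)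
  (hadd : ∀ r s x, φ (r + s) x = φ r x * φ s x) (hcomp : ∀ r s x, φ (r * s) x = φ r (φ s x)) (hone : ∀ x, φ 1 x = x)
  {N : ℕ} [IsDominant (Hom.toSchemeHom ((N : ℤ) • 𝟙 X))] (hN : ∀ x : X.Points K, φ (N : O) x = x ^ N)

omit [IsDedekindDomain O] [IsDominant (Hom.toSchemeHom ((N : ℤ) • 𝟙 X))] in
include hmul hcomp hN in
/-- `φ(r)` preserves `X[N]` (`φ(r)` commutes with `φ(N) = (·)^N`). [cite: MumfordAV1970, §20 (p. 184)] -/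
theorem apply_mem_torsionPoints (r : O) (x : X.torsionPoints K N) : φ r (x : X.Points K) ∈ X.torsionPoints K N := by
  rw [mem_torsionPoints_iff, zpow_natCast, ← hN, ← hcomp, mul_comm, hcomp, hN, coe_torsionPoints_pow_eq_one, map_one_of_mul φ hmul]

/-! ### §1 (ANN) `X[N][𝔟]^⊥ ⊆ X[N][c J′]` -/

include hmul hadd hcomp hN in
/-- **(ANN) THE ANNIHILATOR OF `X[N][𝔟]` IS KILLED BY `c(J′)`, `𝔟·J′ = (N)`.**  `φ : 𝒪 → End X(K)` additive, multiplicative, unital with `φ(N) = (·)^N`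
over a Dedekind domain, `ē^Θ_N`-adjoint along the ring automorphism `c` (`ē(φ(b)P, Q) = ē(P, φ(c b)Q)`, `b ≠ 0`), `ē^Θ_N` right non-degenerate on `X[N](K)`,
`𝔟`, `J′ ≠ 0` with `𝔟·J′ = (N)`: if `y ∈ X[N]` has `ē(x, y) = 1` for every `x ∈ X[N]` killed by `φ(𝔟)`, then `φ(r)y = 1` for every `r ∈ c(J′)`.
[cite: MumfordAV1970, §20 (p. 186) and §23 (p. 208)] [cite: NeukirchANT1999, Ch. I §3] -/
theorem forall_mem_map_apply_eq_one_of_forall_weilPairingLevel_eq_one (c : O ≃+* O) {𝔟 J' : Ideal O} (hJ'0 : J' ≠ ⊥)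
    (h𝔟J' : 𝔟 * J' = Ideal.span {(N : O)}) (Θ : CartierDivisor X.X.left)
    (hadj : ∀ b : O, b ≠ 0 → ∀ P Q P' Q' : X.torsionPoints K N,
      (P' : X.Points K) = φ b P → (Q' : X.Points K) = φ (c b) Q → X.weilPairingLevel Θ P' Q = X.weilPairingLevel Θ P Q')
    (hperf : ∀ Q : X.torsionPoints K N, (∀ P, X.weilPairingLevel Θ P Q = 1) → Q = 1)
    (y : X.torsionPoints K N) (hy : ∀ x : X.torsionPoints K N, (∀ b ∈ 𝔟, φ b x = 1) → X.weilPairingLevel Θ x y = 1) :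
    ∀ r ∈ J'.map (c : O →+* O), φ r y = 1 := by
  classical
  -- two principal multiples `J′·𝔞ₖ = (aₖ)` with `𝔞₁ + 𝔞₂ = 𝒪`
  obtain ⟨a₁, 𝔞₁, ha₁0, h₁, -⟩ := exists_mul_eq_span_and_forall_not_dvd J' hJ'0 ∅
  have h𝔞₁0 : 𝔞₁ ≠ ⊥ := by
    rintro rfl
    rw [Ideal.mul_bot, eq_comm, Ideal.span_singleton_eq_bot] at h₁
    exact ha₁0 h₁
  obtain ⟨a₂, 𝔞₂, ha₂0, h₂, hS₂⟩ := exists_mul_eq_span_and_forall_not_dvd J' hJ'0 (Ideal.finite_factors h𝔞₁0).toFinset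
  have h𝔞 : 𝔞₂ ⊔ 𝔞₁ = ⊤ :=
    (sup_eq_top_iff_forall_not_dvd h𝔞₁0).mpr fun w hw => hS₂ w ((Set.Finite.mem_toFinset _).mpr hw)
  -- `φ(aₖ)` maps `X[N]` into `X[N][𝔟]`, so `φ(c aₖ) y = 1` by adjunction and non-degeneracy
  have hkill : ∀ a ∈ J', a ≠ 0 → φ (c a) y = 1 := by
    intro a haJ ha0
    let Q' : X.torsionPoints K N := ⟨φ (c a) y, apply_mem_torsionPoints φ hmul hcomp hN (c a) y⟩
    suffices hQ' : Q' = 1 from congrArg Subtype.val hQ'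
    refine hperf Q' fun P => ?_
    let P' : X.torsionPoints K N := ⟨φ a P, apply_mem_torsionPoints φ hmul hcomp hN a P⟩
    rw [← hadj a ha0 P y P' Q' rfl rfl]
    refine hy P' (apply_mem_torsion_of_mem φ hcomp (I := 𝔟) (J := J') (y := (P : X.Points K)) ?_ haJ)
    rw [h𝔟J', torsion_span_singleton_iff φ hmul hcomp]
    rw [hN]
    exact coe_torsionPoints_pow_eq_one P
  have ha₁J : a₁ ∈ J' := Ideal.mul_le_right (h₁ ▸ Ideal.mem_span_singleton_self a₁)
  have ha₂J : a₂ ∈ J' := Ideal.mul_le_right (h₂ ▸ Ideal.mem_span_singleton_self a₂)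
  -- `c(J′) = (c a₁) + (c a₂)`
  have hJ' : J'.map (c : O →+* O) = Ideal.span {c a₁} ⊔ Ideal.span {c a₂} := by
    have hJ'eq : J' = Ideal.span {a₁} ⊔ Ideal.span {a₂} := by
      rw [← h₁, ← h₂, ← Ideal.mul_sup, sup_comm, h𝔞, Ideal.mul_top]
    rw [hJ'eq, Ideal.map_sup, Ideal.map_span, Ideal.map_span, Set.image_singleton, Set.image_singleton]
    rfl
  intro r hr
  rw [hJ'] at hr
  obtain ⟨r₁, hr₁, r₂, hr₂, rfl⟩ := Submodule.mem_sup.mp hr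
  obtain ⟨s₁, rfl⟩ := Ideal.mem_span_singleton'.mp hr₁
  obtain ⟨s₂, rfl⟩ := Ideal.mem_span_singleton'.mp hr₂
  rw [hadd, hcomp, hcomp, hkill a₁ ha₁J ha₁0, hkill a₂ ha₂J ha₂0, map_one_of_mul φ hmul, map_one_of_mul φ hmul, mul_one]

/-! ### §2 The annihilator membership clause and the count `#X[N][𝔟] · #X[N][c J′] = #X[N]` -/

variable (hsurj : ∀ r : O, r ≠ 0 → Function.Surjective (φ r))

include hmul hadd hcomp hone hsurj hN in
/-- **`X[N][c J′]` IS the annihilator of `X[N][𝔟]`** (membership clause): for `y ∈ X[N]`, `φ(c J′)y = 1 ↔ ē(x, y) = 1 ∀ x ∈ X[N][𝔟]` — `←` is §1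
(non-degeneracy), `→` is the isotropy ★ `weilPairingLevel_eq_one_of_idealTorsion` (`c(J′)·c(𝔟) = (N)`, Rosati partners `c⁻¹`).
[cite: MumfordAV1970, §23 (p. 208) and (p. 233)] -/
theorem mem_iff_forall_weilPairingLevel_eq_one_of_idealTorsion (c : O ≃+* O) {𝔟 J' : Ideal O} (h𝔟0 : 𝔟 ≠ ⊥) (hJ'0 : J' ≠ ⊥)
    (h𝔟J' : 𝔟 * J' = Ideal.span {(N : O)}) (Θ : CartierDivisor X.X.left)
    (hadj : ∀ b : O, b ≠ 0 → ∀ P Q P' Q' : X.torsionPoints K N,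
      (P' : X.Points K) = φ b P → (Q' : X.Points K) = φ (c b) Q → X.weilPairingLevel Θ P' Q = X.weilPairingLevel Θ P Q')
    (hperf : ∀ Q : X.torsionPoints K N, (∀ P, X.weilPairingLevel Θ P Q = 1) → Q = 1)
    (K𝔟 K𝔠 : Subgroup (X.torsionPoints K N)) (hK𝔟 : ∀ x, x ∈ K𝔟 ↔ ∀ b ∈ 𝔟, φ b x = 1)
    (hK𝔠 : ∀ y, y ∈ K𝔠 ↔ ∀ r ∈ J'.map (c : O →+* O), φ r y = 1) (y : X.torsionPoints K N) :
    y ∈ K𝔠 ↔ ∀ x ∈ K𝔟, X.weilPairingLevel Θ x y = 1 := by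
  refine ⟨fun hy x hx => ?_, fun h => (hK𝔠 y).2
    (forall_mem_map_apply_eq_one_of_forall_weilPairingLevel_eq_one φ hmul hadd hcomp hN c hJ'0 h𝔟J' Θ hadj hperf y
      fun x hx => h x ((hK𝔟 x).2 hx))⟩
  -- isotropy with `𝔟̄ := c(𝔟)`, `𝔠 := c(J′)`: `c(J′)·c(𝔟) = c((N)) = (N)`
  have hc𝔟0 : 𝔟.map (c : O →+* O) ≠ ⊥ := by
    intro h
    exact h𝔟0 ((Ideal.map_eq_bot_iff_of_injective (f := (c : O →+* O)) (by exact c.injective)).1 h)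
  have hcN : 𝔟.map (c : O →+* O) * J'.map (c : O →+* O) = Ideal.span {(N : O)} := by
    rw [← Ideal.map_mul, h𝔟J', Ideal.map_span, Set.image_singleton]
    exact congrArg _ (congrArg _ (map_natCast (c : O →+* O) N))
  have h𝔠 : J'.map (c : O →+* O) * 𝔟.map (c : O →+* O) = Ideal.span {(N : O)} := by rw [mul_comm, hcN]
  refine weilPairingLevel_eq_one_of_idealTorsion φ hmul hadd hcomp hone hsurj hN hc𝔟0 h𝔠 Θ (fun j hj hj0 => ?_) x y
    ((hK𝔟 x).1 hx) ((hK𝔠 y).1 hy)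
  obtain ⟨b, hb, rfl⟩ := (Ideal.mem_map_iff_of_surjective (c : O →+* O) c.surjective).1 hj
  have hb0 : b ≠ 0 := by
    rintro rfl
    exact hj0 (map_zero (c : O →+* O))
  exact ⟨b, hb, hadj b hb0⟩

include hmul hadd hcomp hone hsurj hN in
/-- **(COUNT) `#X[N][𝔟] · #X[N][c J′] = #X[N]`** for `𝔟·J′ = (N)`: `X[N][c J′]` is the `ē^Θ_N`-annihilator of `X[N][𝔟]` (§2 membership clause) and
`ē^Θ_N` is a perfect pairing of the finite group `X[N](K)` (killed by `N`) into `Kˣ`, `K` having enough `N`-th roots of unity — ★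
`PerfectPairingUnits.card_mul_card_eq_card_of_perfect_of_pow_eq_one` ([MumfordAV1970] §23 p. 233: `#K^⊥ = #A[n] ∕ #K`).  Left non-degeneracy comes from
the right one by skew-symmetry (★ `weilPairingLevel_swap`; `N`-th roots exist as `φ(N) = (·)^N` is onto).  With `J′ = c⁻¹(𝔠)`: `#A[𝔟]·#A[𝔠] = #A[N]`, the
engine's `hcard` on `Ω`-points. [cite: MumfordAV1970, §23 (p. 233)] [cite: MumfordAV1970, §20 (p. 186, e_n skew-symmetric and non-degenerate)] -/
theorem natCard_mul_natCard_eq_of_idealTorsion [NeZero N] [HasEnoughRootsOfUnity K N] [Finite (X.torsionPoints K N)]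
    (c : O ≃+* O) {𝔟 J' : Ideal O} (h𝔟0 : 𝔟 ≠ ⊥) (hJ'0 : J' ≠ ⊥) (h𝔟J' : 𝔟 * J' = Ideal.span {(N : O)}) (hN0 : (N : O) ≠ 0)
    (Θ : CartierDivisor X.X.left)
    (hadj : ∀ b : O, b ≠ 0 → ∀ P Q P' Q' : X.torsionPoints K N,
      (P' : X.Points K) = φ b P → (Q' : X.Points K) = φ (c b) Q → X.weilPairingLevel Θ P' Q = X.weilPairingLevel Θ P Q')
    (hperf : ∀ Q : X.torsionPoints K N, (∀ P, X.weilPairingLevel Θ P Q = 1) → Q = 1)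
    (K𝔟 K𝔠 : Subgroup (X.torsionPoints K N)) (hK𝔟 : ∀ x, x ∈ K𝔟 ↔ ∀ b ∈ 𝔟, φ b x = 1)
    (hK𝔠 : ∀ y, y ∈ K𝔠 ↔ ∀ r ∈ J'.map (c : O →+* O), φ r y = 1) :
    Nat.card K𝔟 * Nat.card K𝔠 = Nat.card (X.torsionPoints K N) := by
  -- the pairing as a bilinear homomorphism into `Kˣ`
  let e : X.torsionPoints K N →* X.torsionPoints K N →* Kˣ :=
    { toFun := fun P => weilPairingLevelRightHom Θ P
      map_one' := by
        ext Q
        rw [val_weilPairingLevelRightHom_apply, weilPairingLevel_one_left, MonoidHom.one_apply, Units.val_one]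
      map_mul' := fun P P' => by
        ext Q
        rw [val_weilPairingLevelRightHom_apply, weilPairingLevel_mul_left, MonoidHom.mul_apply, Units.val_mul,
          val_weilPairingLevelRightHom_apply, val_weilPairingLevelRightHom_apply] }
  have he : ∀ P Q, (e P Q : K) = X.weilPairingLevel Θ P Q := fun P Q => rfl
  -- `N`-th roots exist (`φ(N) = (·)^N` is onto), so `ē` is skew-symmetric; `X[N]` is killed by `N`
  have hroot : ∀ P : X.torsionPoints K N, ∃ R : X.Points K, R ^ N = P.1 := fun P => by
    obtain ⟨R, hR⟩ := hsurj (N : O) hN0 P.1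
    exact ⟨R, by rw [← hN, hR]⟩
  have hG : ∀ g : X.torsionPoints K N, g ^ N = 1 := fun g =>
    Subtype.ext ((Subgroup.coe_pow _ _ _).trans (coe_torsionPoints_pow_eq_one g))
  have hr : ∀ h : X.torsionPoints K N, (∀ g, e g h = 1) → h = 1 := fun h hh =>
    hperf h fun P => by rw [← he, hh P, Units.val_one]
  have hl : ∀ g : X.torsionPoints K N, (∀ h, e g h = 1) → g = 1 := fun g hg =>
    hperf g fun P => by rw [weilPairingLevel_swap Θ g P (hroot g) (hroot P), ← he, hg P, Units.val_one, inv_one]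
  refine Literature.GroupTheory.Abelian.PerfectPairingUnits.card_mul_card_eq_card_of_perfect_of_pow_eq_one e hG hG hl hr K𝔟 K𝔠
    fun h => ?_
  rw [mem_iff_forall_weilPairingLevel_eq_one_of_idealTorsion φ hmul hadd hcomp hone hN hsurj c h𝔟0 hJ'0 h𝔟J' Θ hadj hperf K𝔟 K𝔠
    hK𝔟 hK𝔠 h]
  exact ⟨fun H k hk => Units.val_eq_one.1 ((he k h).trans (H k hk)), fun H k hk => (he k h).symm.trans (Units.val_eq_one.2 (H k hk))⟩

end AbelianVariety

end Literature.AlgebraicGeometry.Motives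

end
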